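import Mathlib.Analysis.Convex.Deriv
import Mathlib.Analysis.SpecialFunctions.Pow.Deriv
import Literature.MathematicalPhysics.QuantumFieldTheory.ConformalBootstrap3D.PointFunctionalChord
import Literature.MathematicalPhysics.QuantumFieldTheory.ConformalBootstrap3D.PointCertificateTable

/-!
# Third-order box bounds for the point-functional terms (rule (Q))

The chord rule (`PointFunctionalChord`, rule (M2)) bounds every signed piece `c · r^θ · ρ^η` of a
term `Φ(E, j, s) = Σ_k w_k [v_k^{s} 𝒫_{E,j}(z_k, z̄_k) - u_k^{s} 𝒫_{E,j}(1-z_k, 1-z̄_k)]` on a box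
(`(θ, η) ∈ [0,1]²` the box coordinates, `r, ρ ∈ [1/2, 1]` the node ratios of the two widths) by the
chord/tangent sandwich of `r^θ`, whose gap `θ(1-θ)(log r)²/2 + …` is SECOND order in the width and is
paid PER NODE with `|w_k|`: near the extremal corner of a certificate the heavily cancelling value of the
head sum is far below that loss unless the `s`-width is cut into dozens of pieces. This file gives the
THIRD-order rule (Q). The quadratic sandwich

  `qlo r θ := 1 - θ(1-r) - ½ (1/r - 1)² θ(1-θ) ≤ r^θ ≤ qhi r θ := 1 - θ(1-r) - ½ r (1-r)² θ(1-θ)`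

(`0 < r ≤ 1`, `θ ∈ [0,1]`; both differences vanish at `θ = 0, 1` and are concave in `θ` because
`r (1-r)² ≤ (log r)² r^θ ≤ (1/r - 1)²`, Theorems `qlo_le_rpow`, `rpow_le_qhi`) has a gap of THIRD
order, `≈ |log r|³ θ(1-θ)(1+θ)/2`. Replacing each factor by the quadratic bound on the safe side
(`termQuadPiece`, `termQuadPiece_le`) gives a minorant BIQUADRATIC in `(θ, η)` with an explicit `3 × 3`
coefficient grid (`termQuadCoeff`, `biquadEval`, `termQuadPiece_eq_eval`); summing over the nodes gives ONE
grid per term (`termQuadGrid`, `termQuadBound_le`, `termQuadGrid_le`). A biquadratic is bounded below on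
the unit box by `boxLB g = g₀₀ + Σ_{(i,j) ≠ (0,0)} min(g_{ij}, 0)` (`boxLB_le_biquadEval`). The head sum of
a cell `Δ ∈ [a, b]` is then bounded through ONE polynomial with NET coefficients: with the coefficient
sandwich `A⁻_q ≤ A_q(Δ) ≤ A⁺_q` (`hrCoeff_mem_Icc_cell`),
`Σ_q A_q(Δ) T_q ≥ boxLB(Σ_q A⁻_q G_q) + Σ_q (A⁺_q - A⁻_q) min(boxLB G_q, 0) =: headQuadNumber`
(`headQuad_sum_nonneg`) — cancellation across nodes AND across terms happens before any absolute value
is taken. Consequences: block positivity on the half-open cell from `headQuadNumber ≥ 0`, given the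
certificate's tail rules (`blockPositive_pointFunctional_of_headQuad(_Ico)`,
`headQuad_pointFunctional_of_pointRules`), exactly parallel to `headSum_pointFunctional_of_pointRules`.
The abstract head theorem only asks for grids valid at ONE common box point `(θ, η)` per `(s, Δ)`;
coefficient sub-cells (the substitution `η = i/m + η'/m`) and `s`-pieces are therefore instances of the
same theorem and need no extra theory. Floats (K34 lower box `[0.515, 0.520]`): the `ℓ = 0` head row
certifies the whole hard end `[0.95 - 2⁻⁷, 0.95)` as ONE cell with two `s`-pieces (chord rule: width
`2⁻¹³` fails at 16 pieces), the `ℓ = 6` dip at `Δ ≈ 7.5` with width `2⁻⁸` and four pieces (chord rule: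
width `2⁻¹³` fails at 64 pieces).
Term basis: Hogervorst–Rychkov 2013, §3 eq. (3.6), (3.9). [cite: HogervorstRychkov2013, §3 eq. (3.6)]
-/

noncomputable section

namespace Literature.MathematicalPhysics.QuantumFieldTheory.ConformalBootstrap3D

open Finset Set

/-! ### The quadratic sandwich for `r^θ` -/

/-- lower quadratic bound of `r^θ` on `θ ∈ [0,1]` (`0 < r ≤ 1`). [folklore] -/
def qlo (r θ : ℝ) : ℝ := 1 - θ * (1 - r) - (1 / r - 1) ^ 2 / 2 * (θ * (1 - θ))

/-- upper quadratic bound of `r^θ` on `θ ∈ [0,1]` (`0 < r ≤ 1`). [folklore] -/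
def qhi (r θ : ℝ) : ℝ := 1 - θ * (1 - r) - r * (1 - r) ^ 2 / 2 * (θ * (1 - θ))

/-- `(log r)² ≤ (1/r - 1)²` for `0 < r ≤ 1` (from `log (1/r) ≤ 1/r - 1`). [folklore] -/
theorem log_sq_le_inv_sub_one_sq {r : ℝ} (hr : 0 < r) (hr1 : r ≤ 1) :
    Real.log r ^ 2 ≤ (1 / r - 1) ^ 2 := by
  have h0 : Real.log r ≤ 0 := Real.log_nonpos hr.le hr1
  have h1 : Real.log (1 / r) ≤ 1 / r - 1 := Real.log_le_sub_one_of_pos (by positivity)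
  rw [one_div, Real.log_inv] at h1
  have h2 : 0 ≤ -Real.log r := by linarith
  have h3 : -Real.log r ≤ 1 / r - 1 := by rw [one_div]; linarith
  calc Real.log r ^ 2 = (-Real.log r) ^ 2 := by ring
    _ ≤ (1 / r - 1) ^ 2 := pow_le_pow_left₀ h2 h3 2

/-- `(1 - r)² ≤ (log r)²` for `0 < r ≤ 1` (from `log r ≤ r - 1 ≤ 0`). [folklore] -/
theorem one_sub_sq_le_log_sq {r : ℝ} (hr : 0 < r) (hr1 : r ≤ 1) :
    (1 - r) ^ 2 ≤ Real.log r ^ 2 := by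
  have h1 : Real.log r ≤ r - 1 := Real.log_le_sub_one_of_pos hr
  have h2 : 0 ≤ 1 - r := by linarith
  have h3 : 1 - r ≤ -Real.log r := by linarith
  calc (1 - r) ^ 2 ≤ (-Real.log r) ^ 2 := pow_le_pow_left₀ h2 h3 2
    _ = Real.log r ^ 2 := by ring

/-- A function with `g 0 = 0`, `g 1 = 0`, differentiable on `ℝ` with `g'` differentiable and
`g'' ≤ 0` on `(0, 1)` is `≥ 0` on `[0, 1]` (concavity). [folklore] -/
theorem nonneg_of_concave_ends {g g' g'' : ℝ → ℝ} (h0 : g 0 = 0) (h1 : g 1 = 0)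
    (hg : ∀ x, HasDerivAt g (g' x) x) (hg' : ∀ x, HasDerivAt g' (g'' x) x)
    (hneg : ∀ x ∈ Ioo (0 : ℝ) 1, g'' x ≤ 0) {θ : ℝ} (hθ0 : 0 ≤ θ) (hθ1 : θ ≤ 1) : 0 ≤ g θ := by
  have hconc : ConcaveOn ℝ (Icc (0 : ℝ) 1) g := by
    refine concaveOn_of_hasDerivWithinAt2_nonpos (convex_Icc 0 1) (f' := g') (f'' := g'')
      (fun x _ => (hg x).continuousAt.continuousWithinAt)
      (fun x _ => (hg x).hasDerivWithinAt) (fun x _ => (hg' x).hasDerivWithinAt) ?_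
    intro x hx
    rw [interior_Icc] at hx
    exact hneg x hx
  have h1mem : (1 : ℝ) ∈ Icc (0 : ℝ) 1 := ⟨zero_le_one, le_rfl⟩
  have h0mem : (0 : ℝ) ∈ Icc (0 : ℝ) 1 := ⟨le_rfl, zero_le_one⟩
  have hb : (0 : ℝ) ≤ 1 - θ := by linarith
  have hab : θ + (1 - θ) = 1 := by ring
  have key := hconc.2 h1mem h0mem hθ0 hb hab
  simp only [smul_eq_mul, h0, h1, mul_zero, mul_one, add_zero] at key
  exact key

/-- **Lower quadratic bound**: `qlo r θ ≤ r^θ` for `0 < r ≤ 1`, `θ ∈ [0,1]`. [folklore] -/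
theorem qlo_le_rpow {r θ : ℝ} (hr : 0 < r) (hr1 : r ≤ 1) (hθ0 : 0 ≤ θ) (hθ1 : θ ≤ 1) :
    qlo r θ ≤ r ^ θ := by
  set K := (1 / r - 1) ^ 2 with hK
  -- g θ = r^θ - qlo r θ
  have hg : ∀ x, HasDerivAt (fun x => r ^ x - qlo r x)
      (r ^ x * Real.log r + (1 - r) + K / 2 * (1 - 2 * x)) x := by
    intro x
    have h1 := (Real.hasStrictDerivAt_const_rpow hr x).hasDerivAt
    have h2 : HasDerivAt (fun x => qlo r x) (-(1 - r) - K / 2 * (1 - 2 * x)) x := by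
      have ha := ((hasDerivAt_id x).mul ((hasDerivAt_const x (1 : ℝ)).sub (hasDerivAt_id x)))
      have hb := ((hasDerivAt_id x).mul_const (1 - r))
      have hc := (hb.const_sub 1).sub (ha.const_mul (K / 2))
      refine hc.congr_deriv ?_
      simp only [id_eq, Pi.sub_apply]; ring
    exact (h1.sub h2).congr_deriv (by ring)
  have hg' : ∀ x, HasDerivAt (fun x => r ^ x * Real.log r + (1 - r) + K / 2 * (1 - 2 * x))
      (r ^ x * Real.log r ^ 2 - K) x := by
    intro x
    have h1 := ((Real.hasStrictDerivAt_const_rpow hr x).hasDerivAt.mul_const (Real.log r))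
    have h2 := (((hasDerivAt_id x).const_mul (2 : ℝ)).const_sub 1).const_mul (K / 2)
    refine ((h1.add_const (1 - r)).add h2).congr_deriv ?_
    ring
  have h0 : (fun x => r ^ x - qlo r x) 0 = 0 := by
    show r ^ (0 : ℝ) - qlo r 0 = 0
    rw [Real.rpow_zero]; unfold qlo; ring
  have h1 : (fun x => r ^ x - qlo r x) 1 = 0 := by
    show r ^ (1 : ℝ) - qlo r 1 = 0
    rw [Real.rpow_one]; unfold qlo; ring
  have := nonneg_of_concave_ends (g := fun x => r ^ x - qlo r x) h0 h1 hg hg' ?_ hθ0 hθ1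
  · exact sub_nonneg.mp this
  intro x hx
  have hx1 : r ^ x ≤ 1 := Real.rpow_le_one hr.le hr1 hx.1.le
  have hl := log_sq_le_inv_sub_one_sq hr hr1
  have hpos : 0 ≤ r ^ x := Real.rpow_nonneg hr.le x
  have : r ^ x * Real.log r ^ 2 ≤ 1 * (1 / r - 1) ^ 2 :=
    mul_le_mul hx1 hl (sq_nonneg _) zero_le_one
  linarith

/-- **Upper quadratic bound**: `r^θ ≤ qhi r θ` for `0 < r ≤ 1`, `θ ∈ [0,1]`. [folklore] -/
theorem rpow_le_qhi {r θ : ℝ} (hr : 0 < r) (hr1 : r ≤ 1) (hθ0 : 0 ≤ θ) (hθ1 : θ ≤ 1) :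
    r ^ θ ≤ qhi r θ := by
  set K := r * (1 - r) ^ 2 with hK
  have hg : ∀ x, HasDerivAt (fun x => qhi r x - r ^ x)
      (-(1 - r) - K / 2 * (1 - 2 * x) - r ^ x * Real.log r) x := by
    intro x
    have h1 := (Real.hasStrictDerivAt_const_rpow hr x).hasDerivAt
    have h2 : HasDerivAt (fun x => qhi r x) (-(1 - r) - K / 2 * (1 - 2 * x)) x := by
      have ha := ((hasDerivAt_id x).mul ((hasDerivAt_const x (1 : ℝ)).sub (hasDerivAt_id x)))
      have hb := ((hasDerivAt_id x).mul_const (1 - r))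
      have hc := (hb.const_sub 1).sub (ha.const_mul (K / 2))
      refine hc.congr_deriv ?_
      simp only [id_eq, Pi.sub_apply]; ring
    exact (h2.sub h1).congr_deriv (by ring)
  have hg' : ∀ x, HasDerivAt (fun x => -(1 - r) - K / 2 * (1 - 2 * x) - r ^ x * Real.log r)
      (K - r ^ x * Real.log r ^ 2) x := by
    intro x
    have h1 := ((Real.hasStrictDerivAt_const_rpow hr x).hasDerivAt.mul_const (Real.log r))
    have h2 := (((hasDerivAt_id x).const_mul (2 : ℝ)).const_sub 1).const_mul (K / 2)
    refine ((h2.const_sub (-(1 - r))).sub h1).congr_deriv ?_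
    ring
  have h0 : (fun x => qhi r x - r ^ x) 0 = 0 := by
    show qhi r 0 - r ^ (0 : ℝ) = 0
    rw [Real.rpow_zero]; unfold qhi; ring
  have h1 : (fun x => qhi r x - r ^ x) 1 = 0 := by
    show qhi r 1 - r ^ (1 : ℝ) = 0
    rw [Real.rpow_one]; unfold qhi; ring
  have := nonneg_of_concave_ends (g := fun x => qhi r x - r ^ x) h0 h1 hg hg' ?_ hθ0 hθ1
  · exact sub_nonneg.mp this
  intro x hx
  have hx1 : r ≤ r ^ x := Real.self_le_rpow_of_le_one hr.le hr1 hx.2.le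
  have hl := one_sub_sq_le_log_sq hr hr1
  have : r * (1 - r) ^ 2 ≤ r ^ x * Real.log r ^ 2 := mul_le_mul hx1 hl (sq_nonneg _)
    (Real.rpow_nonneg hr.le x)
  linarith

/-- `qlo r θ ≥ 0` for `r ∈ [1/2, 1]`, `θ ∈ [0,1]` (indeed `≥ r - 1/8`). [folklore] -/
theorem qlo_nonneg {r θ : ℝ} (hr : 1 / 2 ≤ r) (hr1 : r ≤ 1) (hθ0 : 0 ≤ θ) (hθ1 : θ ≤ 1) :
    0 ≤ qlo r θ := by
  have hr0 : 0 < r := by linarith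
  have hx0 : 0 ≤ 1 / r - 1 := by
    have : 1 ≤ 1 / r := by rw [le_div_iff₀ hr0]; linarith
    linarith
  have hx1 : 1 / r - 1 ≤ 1 := by
    have : 1 / r ≤ 2 := by rw [div_le_iff₀ hr0]; linarith
    linarith
  have hK : (1 / r - 1) ^ 2 ≤ 1 := by nlinarith
  have hq : θ * (1 - θ) ≤ 1 / 4 := by nlinarith [sq_nonneg (2 * θ - 1)]
  have hq0 : 0 ≤ θ * (1 - θ) := mul_nonneg hθ0 (by linarith)
  have h1 : (1 / r - 1) ^ 2 * (θ * (1 - θ)) ≤ 1 * (1 / 4) := mul_le_mul hK hq hq0 zero_le_one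
  have h2 : θ * (1 - r) ≤ 1 - r := by nlinarith
  unfold qlo
  linarith

/-! ### The signed piece and its biquadratic minorant -/

/-- Safe-side quadratic minorant of `c · r^θ · ρ^η`: lower factors for `c ≥ 0`, upper factors for
`c < 0`. [folklore] -/
def termQuadPiece (c θ η r ρ : ℝ) : ℝ :=
  max c 0 * (qlo r θ * qlo ρ η) - max (-c) 0 * (qhi r θ * qhi ρ η)

/-- `termQuadPiece c θ η r ρ ≤ c r^θ ρ^η` for `r, ρ ∈ [1/2, 1]`, `(θ, η) ∈ [0,1]²`. [folklore] -/
theorem termQuadPiece_le {c θ η r ρ : ℝ} (hr : 1 / 2 ≤ r) (hr1 : r ≤ 1) (hρ : 1 / 2 ≤ ρ)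
    (hρ1 : ρ ≤ 1) (hθ0 : 0 ≤ θ) (hθ1 : θ ≤ 1) (hη0 : 0 ≤ η) (hη1 : η ≤ 1) :
    termQuadPiece c θ η r ρ ≤ c * (r ^ θ * ρ ^ η) := by
  have hr0 : 0 < r := by linarith
  have hρ0 : 0 < ρ := by linarith
  have hL1 := qlo_le_rpow hr0 hr1 hθ0 hθ1
  have hL2 := qlo_le_rpow hρ0 hρ1 hη0 hη1
  have hU1 := rpow_le_qhi hr0 hr1 hθ0 hθ1
  have hU2 := rpow_le_qhi hρ0 hρ1 hη0 hη1
  have hL2nn : 0 ≤ qlo ρ η := qlo_nonneg hρ hρ1 hη0 hη1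
  have hf1 : 0 ≤ r ^ θ := Real.rpow_nonneg hr0.le θ
  have hf2 : 0 ≤ ρ ^ η := Real.rpow_nonneg hρ0.le η
  have hU1nn : 0 ≤ qhi r θ := hf1.trans hU1
  have hlow : qlo r θ * qlo ρ η ≤ r ^ θ * ρ ^ η := mul_le_mul hL1 hL2 hL2nn hf1
  have hup : r ^ θ * ρ ^ η ≤ qhi r θ * qhi ρ η := mul_le_mul hU1 hU2 hf2 hU1nn
  have hc : c = max c 0 - max (-c) 0 := by
    rcases le_or_gt 0 c with h | h
    · rw [max_eq_left h, max_eq_right (by linarith : -c ≤ 0)]; ring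
    · rw [max_eq_right h.le, max_eq_left (by linarith : 0 ≤ -c)]; ring
  have hp : 0 ≤ max c 0 := le_max_right _ _
  have hm : 0 ≤ max (-c) 0 := le_max_right _ _
  calc termQuadPiece c θ η r ρ
      ≤ max c 0 * (r ^ θ * ρ ^ η) - max (-c) 0 * (r ^ θ * ρ ^ η) := by
        unfold termQuadPiece
        exact sub_le_sub (mul_le_mul_of_nonneg_left hlow hp) (mul_le_mul_of_nonneg_left hup hm)
    _ = (max c 0 - max (-c) 0) * (r ^ θ * ρ ^ η) := by ring
    _ = c * (r ^ θ * ρ ^ η) := by rw [← hc]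

/-! ### Biquadratic polynomials by their `3 × 3` coefficient grids -/

/-- evaluation of the biquadratic with coefficient grid `g` (indices `< 3` used) at `(θ, η)`. [folklore] -/
def biquadEval (g : ℕ → ℕ → ℝ) (θ η : ℝ) : ℝ :=
  ∑ i ∈ range 3, ∑ j ∈ range 3, g i j * θ ^ i * η ^ j

/-- the coefficients of `qlo r` as a quadratic in `θ`. [folklore] -/
def qloCoeff (r : ℝ) : ℕ → ℝ
  | 0 => 1
  | 1 => -(1 - r) - (1 / r - 1) ^ 2 / 2
  | 2 => (1 / r - 1) ^ 2 / 2
  | _ => 0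

/-- the coefficients of `qhi r` as a quadratic in `θ`. [folklore] -/
def qhiCoeff (r : ℝ) : ℕ → ℝ
  | 0 => 1
  | 1 => -(1 - r) - r * (1 - r) ^ 2 / 2
  | 2 => r * (1 - r) ^ 2 / 2
  | _ => 0

/-- the `3 × 3` coefficient grid of `termQuadPiece c · · r ρ`. [folklore] -/
def termQuadCoeff (c r ρ : ℝ) (i j : ℕ) : ℝ :=
  max c 0 * (qloCoeff r i * qloCoeff ρ j) - max (-c) 0 * (qhiCoeff r i * qhiCoeff ρ j)

/-- the piece is the evaluation of its grid. [folklore] -/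
theorem termQuadPiece_eq_eval (c θ η r ρ : ℝ) :
    termQuadPiece c θ η r ρ = biquadEval (termQuadCoeff c r ρ) θ η := by
  simp only [termQuadPiece, biquadEval, termQuadCoeff, qlo, qhi, Finset.sum_range_succ,
    Finset.sum_range_zero, qloCoeff, qhiCoeff]
  ring

/-- the lower box number of a grid: `g₀₀ + Σ_{(i,j) ≠ (0,0)} min(g_{ij}, 0)`. [folklore] -/
def boxLB (g : ℕ → ℕ → ℝ) : ℝ :=
  ∑ i ∈ range 3, ∑ j ∈ range 3, if i = 0 ∧ j = 0 then g 0 0 else min (g i j) 0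

/-- **Box bound of a biquadratic**: on `[0,1]²` every monomial lies in `[0,1]`, so
`boxLB g ≤ biquadEval g θ η`. [folklore] -/
theorem boxLB_le_biquadEval (g : ℕ → ℕ → ℝ) {θ η : ℝ} (hθ : θ ∈ Icc (0 : ℝ) 1)
    (hη : η ∈ Icc (0 : ℝ) 1) : boxLB g ≤ biquadEval g θ η := by
  unfold boxLB biquadEval
  refine Finset.sum_le_sum (fun i _ => Finset.sum_le_sum (fun j _ => ?_))
  have hm0 : 0 ≤ θ ^ i * η ^ j := mul_nonneg (pow_nonneg hθ.1 i) (pow_nonneg hη.1 j)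
  have hm1 : θ ^ i * η ^ j ≤ 1 :=
    mul_le_one₀ (pow_le_one₀ hθ.1 hθ.2) (pow_nonneg hη.1 j) (pow_le_one₀ hη.1 hη.2)
  by_cases h : i = 0 ∧ j = 0
  · obtain ⟨rfl, rfl⟩ := h
    simp
  · rw [if_neg h]
    rcases le_or_gt 0 (g i j) with hg | hg
    · rw [min_eq_right hg, mul_assoc]; exact mul_nonneg hg hm0
    · rw [min_eq_left hg.le, mul_assoc]
      have : g i j * (θ ^ i * η ^ j) ≥ g i j * 1 := mul_le_mul_of_nonpos_left hm1 hg.le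
      linarith

/-- `biquadEval` is linear in the grid: finite linear combinations. [folklore] -/
theorem biquadEval_sum_mul {ι : Type*} (s : Finset ι) (a : ι → ℝ) (G : ι → ℕ → ℕ → ℝ) (θ η : ℝ) :
    biquadEval (fun i j => ∑ q ∈ s, a q * G q i j) θ η = ∑ q ∈ s, a q * biquadEval (G q) θ η := by
  symm
  calc ∑ q ∈ s, a q * biquadEval (G q) θ η
      = ∑ q ∈ s, ∑ i ∈ range 3, ∑ j ∈ range 3, a q * G q i j * θ ^ i * η ^ j := by
        refine Finset.sum_congr rfl (fun q _ => ?_)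
        rw [biquadEval, Finset.mul_sum]
        refine Finset.sum_congr rfl (fun i _ => ?_)
        rw [Finset.mul_sum]
        refine Finset.sum_congr rfl (fun j _ => ?_)
        ring
    _ = ∑ i ∈ range 3, ∑ q ∈ s, ∑ j ∈ range 3, a q * G q i j * θ ^ i * η ^ j := Finset.sum_comm
    _ = ∑ i ∈ range 3, ∑ j ∈ range 3, ∑ q ∈ s, a q * G q i j * θ ^ i * η ^ j := by
        refine Finset.sum_congr rfl (fun i _ => ?_)
        exact Finset.sum_comm
    _ = biquadEval (fun i j => ∑ q ∈ s, a q * G q i j) θ η := by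
        rw [biquadEval]
        refine Finset.sum_congr rfl (fun i _ => Finset.sum_congr rfl (fun j _ => ?_))
        rw [Finset.sum_mul, Finset.sum_mul]

/-- `biquadEval` is additive in the grid. [folklore] -/
theorem biquadEval_add (g h : ℕ → ℕ → ℝ) (θ η : ℝ) :
    biquadEval (fun i j => g i j + h i j) θ η = biquadEval g θ η + biquadEval h θ η := by
  simp only [biquadEval, add_mul, Finset.sum_add_distrib]

/-- `biquadEval` of a finite sum of grids. [folklore] -/
theorem biquadEval_finsum {ι : Type*} (s : Finset ι) (G : ι → ℕ → ℕ → ℝ) (θ η : ℝ) :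
    biquadEval (fun i j => ∑ q ∈ s, G q i j) θ η = ∑ q ∈ s, biquadEval (G q) θ η := by
  have := biquadEval_sum_mul s (fun _ => (1 : ℝ)) G θ η
  simpa only [one_mul] using this

/-! ### The quadratic bound of a term on a box -/

/-- The biquadratic minorant of `Φ(E, j, s)` at box coordinates `(θ, η)` (`s = s_lo + θ (s_hi - s_lo)`,
`E = E_lo + η (E_hi - E_lo)`): the node sum of the quadratic pieces, with the data of
`termChordBound`. [cite: HogervorstRychkov2013, §3 eq. (3.6)] -/
def termQuadBound {N : ℕ} (w z zb : Fin N → ℝ) (j : ℕ) (slo shi Elo Ehi θ η : ℝ) : ℝ :=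
  ∑ k, (termQuadPiece (w k * (((1 - z k) * (1 - zb k)) ^ slo * zMono Elo j (z k) (zb k))) θ η
        (((1 - z k) * (1 - zb k)) ^ (shi - slo)) ((z k * zb k) ^ ((Ehi - Elo) / 2))
      + termQuadPiece (-(w k * ((z k * zb k) ^ slo * zMono Elo j (1 - z k) (1 - zb k)))) θ η
        ((z k * zb k) ^ (shi - slo)) (((1 - z k) * (1 - zb k)) ^ ((Ehi - Elo) / 2)))

/-- The `3 × 3` coefficient grid of node `k`'s two pieces. [cite: HogervorstRychkov2013, §3 eq. (3.6)] -/
def termQuadNodeGrid {N : ℕ} (w z zb : Fin N → ℝ) (j : ℕ) (slo shi Elo Ehi : ℝ) (k : Fin N)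
    (i i' : ℕ) : ℝ :=
  termQuadCoeff (w k * (((1 - z k) * (1 - zb k)) ^ slo * zMono Elo j (z k) (zb k)))
      (((1 - z k) * (1 - zb k)) ^ (shi - slo)) ((z k * zb k) ^ ((Ehi - Elo) / 2)) i i'
    + termQuadCoeff (-(w k * ((z k * zb k) ^ slo * zMono Elo j (1 - z k) (1 - zb k))))
      ((z k * zb k) ^ (shi - slo)) (((1 - z k) * (1 - zb k)) ^ ((Ehi - Elo) / 2)) i i'

/-- The `3 × 3` coefficient grid of `termQuadBound` (node sum of the piece grids).
[cite: HogervorstRychkov2013, §3 eq. (3.6)] -/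
def termQuadGrid {N : ℕ} (w z zb : Fin N → ℝ) (j : ℕ) (slo shi Elo Ehi : ℝ) (i i' : ℕ) : ℝ :=
  ∑ k, termQuadNodeGrid w z zb j slo shi Elo Ehi k i i'

/-- the term bound is the evaluation of its grid. [folklore] -/
theorem termQuadBound_eq_eval {N : ℕ} (w z zb : Fin N → ℝ) (j : ℕ) (slo shi Elo Ehi θ η : ℝ) :
    termQuadBound w z zb j slo shi Elo Ehi θ η = biquadEval (termQuadGrid w z zb j slo shi Elo Ehi) θ η := by
  have h1 : termQuadBound w z zb j slo shi Elo Ehi θ η =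
      ∑ k, biquadEval (termQuadNodeGrid w z zb j slo shi Elo Ehi k) θ η := by
    unfold termQuadBound
    refine Finset.sum_congr rfl (fun k _ => ?_)
    rw [termQuadPiece_eq_eval, termQuadPiece_eq_eval, ← biquadEval_add]
    rfl
  rw [h1]
  exact (biquadEval_finsum (Finset.univ : Finset (Fin N)) (termQuadNodeGrid w z zb j slo shi Elo Ehi) θ η).symm

/-- **The quadratic bound at box coordinates.** Nodes in the open square, `s_lo ≤ s_hi`,
`E_lo ≤ E_hi`, every node's four ratios `≥ 1/2`; then for `(θ, η) ∈ [0,1]²`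
`termQuadBound … θ η ≤ Φ(E_lo + η (E_hi - E_lo), j, s_lo + θ (s_hi - s_lo))`.
[cite: HogervorstRychkov2013, §3 eq. (3.6)] -/
theorem termQuadBound_le {N : ℕ} (w z zb : Fin N → ℝ)
    (hz : ∀ k, z k ∈ Ioo (0 : ℝ) 1) (hzb : ∀ k, zb k ∈ Ioo (0 : ℝ) 1) (j : ℕ)
    {slo shi Elo Ehi θ η : ℝ} (hs : slo ≤ shi) (hE : Elo ≤ Ehi)
    (hr : ∀ k, 1 / 2 ≤ ((1 - z k) * (1 - zb k)) ^ (shi - slo) ∧ 1 / 2 ≤ (z k * zb k) ^ (shi - slo))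
    (hρ : ∀ k, 1 / 2 ≤ (z k * zb k) ^ ((Ehi - Elo) / 2) ∧
      1 / 2 ≤ ((1 - z k) * (1 - zb k)) ^ ((Ehi - Elo) / 2))
    (hθ : θ ∈ Icc (0 : ℝ) 1) (hη : η ∈ Icc (0 : ℝ) 1) :
    termQuadBound w z zb j slo shi Elo Ehi θ η ≤
      pointFunctional w z zb (crossF (slo + θ * (shi - slo)) (-1)
        (zMono (Elo + η * (Ehi - Elo)) j)) := by
  rw [pointFunctional_apply]
  unfold termQuadBound
  refine Finset.sum_le_sum (fun k _ => ?_)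
  have hzk := hz k; have hzbk := hzb k
  have hv : 0 < (1 - z k) * (1 - zb k) := mul_pos (by linarith [hzk.2]) (by linarith [hzbk.2])
  have hu : 0 < z k * zb k := mul_pos hzk.1 hzbk.1
  have hv1 : (1 - z k) * (1 - zb k) ≤ 1 := by nlinarith [hzk.1, hzk.2, hzbk.1, hzbk.2]
  have hu1 : z k * zb k ≤ 1 := by nlinarith [hzk.1, hzk.2, hzbk.1, hzbk.2]
  have hds : 0 ≤ shi - slo := by linarith
  have hdE : 0 ≤ (Ehi - Elo) / 2 := by linarith
  have hr1 : ((1 - z k) * (1 - zb k)) ^ (shi - slo) ≤ 1 := Real.rpow_le_one hv.le hv1 hds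
  have hr2 : (z k * zb k) ^ (shi - slo) ≤ 1 := Real.rpow_le_one hu.le hu1 hds
  have hρ1 : (z k * zb k) ^ ((Ehi - Elo) / 2) ≤ 1 := Real.rpow_le_one hu.le hu1 hdE
  have hρ2 : ((1 - z k) * (1 - zb k)) ^ ((Ehi - Elo) / 2) ≤ 1 := Real.rpow_le_one hv.le hv1 hdE
  -- the two pieces
  have h1 := termQuadPiece_le (c := w k * (((1 - z k) * (1 - zb k)) ^ slo * zMono Elo j (z k) (zb k)))
    (hr k).1 hr1 (hρ k).1 hρ1 hθ.1 hθ.2 hη.1 hη.2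
  have h2 := termQuadPiece_le (c := -(w k * ((z k * zb k) ^ slo * zMono Elo j (1 - z k) (1 - zb k))))
    (hr k).2 hr2 (hρ k).2 hρ2 hθ.1 hθ.2 hη.1 hη.2
  -- rewrite the exact term
  have hvs : ((1 - z k) * (1 - zb k)) ^ (slo + θ * (shi - slo)) =
      ((1 - z k) * (1 - zb k)) ^ slo * (((1 - z k) * (1 - zb k)) ^ (shi - slo)) ^ θ := by
    rw [Real.rpow_add hv, ← Real.rpow_mul hv.le, mul_comm (shi - slo) θ]
  have hus : (z k * zb k) ^ (slo + θ * (shi - slo)) =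
      (z k * zb k) ^ slo * ((z k * zb k) ^ (shi - slo)) ^ θ := by
    rw [Real.rpow_add hu, ← Real.rpow_mul hu.le, mul_comm (shi - slo) θ]
  have hEd : zMono (Elo + η * (Ehi - Elo)) j (z k) (zb k) =
      zMono Elo j (z k) (zb k) * ((z k * zb k) ^ ((Ehi - Elo) / 2)) ^ η := by
    rw [zMono_add Elo _ j hzk.1 hzbk.1, ← Real.rpow_mul hu.le]
    congr 1; congr 1; ring
  have hEr : zMono (Elo + η * (Ehi - Elo)) j (1 - z k) (1 - zb k) =
      zMono Elo j (1 - z k) (1 - zb k) * (((1 - z k) * (1 - zb k)) ^ ((Ehi - Elo) / 2)) ^ η := by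
    rw [zMono_add Elo _ j (by linarith [hzk.2]) (by linarith [hzbk.2]), ← Real.rpow_mul hv.le]
    congr 1; congr 1; ring
  have key : termQuadPiece (w k * (((1 - z k) * (1 - zb k)) ^ slo * zMono Elo j (z k) (zb k))) θ η
        (((1 - z k) * (1 - zb k)) ^ (shi - slo)) ((z k * zb k) ^ ((Ehi - Elo) / 2))
      + termQuadPiece (-(w k * ((z k * zb k) ^ slo * zMono Elo j (1 - z k) (1 - zb k)))) θ η
        ((z k * zb k) ^ (shi - slo)) (((1 - z k) * (1 - zb k)) ^ ((Ehi - Elo) / 2)) ≤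
      w k * (((1 - z k) * (1 - zb k)) ^ (slo + θ * (shi - slo)) *
          zMono (Elo + η * (Ehi - Elo)) j (z k) (zb k))
        + -(w k * ((z k * zb k) ^ (slo + θ * (shi - slo)) *
          zMono (Elo + η * (Ehi - Elo)) j (1 - z k) (1 - zb k))) := by
    rw [hvs, hus, hEd, hEr]
    calc _ ≤ w k * (((1 - z k) * (1 - zb k)) ^ slo * zMono Elo j (z k) (zb k)) *
            ((((1 - z k) * (1 - zb k)) ^ (shi - slo)) ^ θ * ((z k * zb k) ^ ((Ehi - Elo) / 2)) ^ η)
          + -(w k * ((z k * zb k) ^ slo * zMono Elo j (1 - z k) (1 - zb k))) *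
            (((z k * zb k) ^ (shi - slo)) ^ θ * (((1 - z k) * (1 - zb k)) ^ ((Ehi - Elo) / 2)) ^ η) :=
          add_le_add h1 h2
      _ = _ := by ring
  refine key.trans (le_of_eq ?_)
  simp only [crossF]
  ring

/-- **The term grid is a minorant**: for `s ∈ [s_lo, s_hi]` with `s = s_lo + θ (s_hi - s_lo)` and
`E = E_lo + η (E_hi - E_lo)`, `biquadEval (termQuadGrid …) θ η ≤ Φ(E, j, s)`.
[cite: HogervorstRychkov2013, §3 eq. (3.6)] -/
theorem termQuadGrid_le {N : ℕ} (w z zb : Fin N → ℝ)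
    (hz : ∀ k, z k ∈ Ioo (0 : ℝ) 1) (hzb : ∀ k, zb k ∈ Ioo (0 : ℝ) 1) (j : ℕ)
    {slo shi Elo Ehi θ η : ℝ} (hs : slo ≤ shi) (hE : Elo ≤ Ehi)
    (hr : ∀ k, 1 / 2 ≤ ((1 - z k) * (1 - zb k)) ^ (shi - slo) ∧ 1 / 2 ≤ (z k * zb k) ^ (shi - slo))
    (hρ : ∀ k, 1 / 2 ≤ (z k * zb k) ^ ((Ehi - Elo) / 2) ∧
      1 / 2 ≤ ((1 - z k) * (1 - zb k)) ^ ((Ehi - Elo) / 2))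
    (hθ : θ ∈ Icc (0 : ℝ) 1) (hη : η ∈ Icc (0 : ℝ) 1) :
    biquadEval (termQuadGrid w z zb j slo shi Elo Ehi) θ η ≤
      pointFunctional w z zb (crossF (slo + θ * (shi - slo)) (-1)
        (zMono (Elo + η * (Ehi - Elo)) j)) := by
  rw [← termQuadBound_eq_eval]
  exact termQuadBound_le w z zb hz hzb j hs hE hr hρ hθ hη

/-- box coordinates: every `s ∈ [s_lo, s_hi]` is `s_lo + θ (s_hi - s_lo)` with `θ ∈ [0,1]`. [folklore] -/
theorem exists_boxCoord {slo shi s : ℝ} (hs : s ∈ Icc slo shi) :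
    ∃ θ : ℝ, θ ∈ Icc (0 : ℝ) 1 ∧ s = slo + θ * (shi - slo) := by
  rcases eq_or_lt_of_le (hs.1.trans hs.2) with h | h
  · exact ⟨0, ⟨le_rfl, zero_le_one⟩, by simp; linarith [hs.1, hs.2]⟩
  · have hne : shi - slo ≠ 0 := ne_of_gt (sub_pos.2 h)
    refine ⟨(s - slo) / (shi - slo), ⟨div_nonneg (by linarith [hs.1]) (by linarith),
      (div_le_one (by linarith)).2 (by linarith [hs.2])⟩, ?_⟩
    rw [div_mul_cancel₀ _ hne]; ring

/-! ### Quadratic head cells: ONE net polynomial per cell -/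

/-- The quadratic head-cell number for spin `ℓ`, cell `[a, b]`, head index set `F` and one
`3 × 3` grid `G q` per head term: with `A⁻_q = A_q(a) P_n(a)/P_n(b)`, `A⁺_q = A_q(b) P_n(b)/P_n(a)`
(`hrCoeff_mem_Icc_cell`),
`boxLB(Σ_{q ∈ F} A⁻_q G_q) + Σ_{q ∈ F} (A⁺_q - A⁻_q) · min(boxLB G_q, 0)`.
[cite: HogervorstRychkov2013, §3 eq. (3.9)] -/
def headQuadNumber (ℓ : ℕ) (a b : ℝ) (F : Finset (ℕ × ℕ)) (G : ℕ × ℕ → ℕ → ℕ → ℝ) : ℝ :=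
  boxLB (fun i j => ∑ q ∈ F,
      hrCoeff a ℓ q.1 q.2 * (pivotProd a ℓ q.1 / pivotProd b ℓ q.1) * G q i j)
    + ∑ q ∈ F, (hrCoeff b ℓ q.1 q.2 * (pivotProd b ℓ q.1 / pivotProd a ℓ q.1)
        - hrCoeff a ℓ q.1 q.2 * (pivotProd a ℓ q.1 / pivotProd b ℓ q.1)) * min (boxLB (G q)) 0

/-- The algebra of the quadratic head cell: coefficients `c_q ∈ [A⁻_q, A⁺_q]`, `c_q ≥ 0`, grids below
`T_q` at a common box point. [folklore] -/
theorem sum_mul_nonneg_of_boxNumber {θ η : ℝ} (hθ : θ ∈ Icc (0 : ℝ) 1) (hη : η ∈ Icc (0 : ℝ) 1)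
    (F : Finset (ℕ × ℕ)) (G : ℕ × ℕ → ℕ → ℕ → ℝ) (T c Alo Ahi : ℕ × ℕ → ℝ)
    (hA : ∀ q ∈ F, Alo q ≤ c q ∧ c q ≤ Ahi q) (hc0 : ∀ q ∈ F, 0 ≤ c q)
    (hG : ∀ q ∈ F, biquadEval (G q) θ η ≤ T q)
    (hnum : 0 ≤ boxLB (fun i j => ∑ q ∈ F, Alo q * G q i j)
      + ∑ q ∈ F, (Ahi q - Alo q) * min (boxLB (G q)) 0) :
    0 ≤ ∑ q ∈ F, c q * T q := by
  -- Σ c T ≥ Σ c P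
  have h1 : ∑ q ∈ F, c q * biquadEval (G q) θ η ≤ ∑ q ∈ F, c q * T q :=
    Finset.sum_le_sum (fun q hq => mul_le_mul_of_nonneg_left (hG q hq) (hc0 q hq))
  refine le_trans ?_ h1
  -- split c = Alo + (c - Alo)
  have h2 : ∑ q ∈ F, c q * biquadEval (G q) θ η =
      ∑ q ∈ F, Alo q * biquadEval (G q) θ η + ∑ q ∈ F, (c q - Alo q) * biquadEval (G q) θ η := by
    rw [← Finset.sum_add_distrib]; exact Finset.sum_congr rfl (fun q _ => by ring)
  rw [h2]
  have h3 : boxLB (fun i j => ∑ q ∈ F, Alo q * G q i j) ≤ ∑ q ∈ F, Alo q * biquadEval (G q) θ η := by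
    rw [← biquadEval_sum_mul]; exact boxLB_le_biquadEval _ hθ hη
  have h4 : ∀ q ∈ F, (Ahi q - Alo q) * min (boxLB (G q)) 0 ≤ (c q - Alo q) * biquadEval (G q) θ η := by
    intro q hq
    have hm : min (boxLB (G q)) 0 ≤ 0 := min_le_right _ _
    have hw : c q - Alo q ≤ Ahi q - Alo q := by linarith [(hA q hq).2]
    have hw0 : 0 ≤ c q - Alo q := by linarith [(hA q hq).1]
    calc (Ahi q - Alo q) * min (boxLB (G q)) 0
        ≤ (c q - Alo q) * min (boxLB (G q)) 0 := mul_le_mul_of_nonpos_right hw hm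
      _ ≤ (c q - Alo q) * biquadEval (G q) θ η :=
          mul_le_mul_of_nonneg_left ((min_le_left _ _).trans (boxLB_le_biquadEval _ hθ hη)) hw0
  have h5 := Finset.sum_le_sum h4
  linarith

/-- **The head sum from ONE number.** `ℓ + 1 ≤ a`, `Δ ∈ [a, b]`, `(θ, η) ∈ [0,1]²`; if every grid
`G q` evaluated at `(θ, η)` is below `T q` and `headQuadNumber ≥ 0` then `Σ_{q ∈ F} A_q(Δ) T_q ≥ 0`.
(The common box point `(θ, η)` is arbitrary: coefficient sub-cells and `s`-pieces are instances.)
[cite: HogervorstRychkov2013, §3 eq. (3.9)] -/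
theorem headQuad_sum_nonneg {ℓ : ℕ} {a b Δ θ η : ℝ} (ha : (ℓ : ℝ) + 1 ≤ a) (hΔ : Δ ∈ Icc a b)
    (hθ : θ ∈ Icc (0 : ℝ) 1) (hη : η ∈ Icc (0 : ℝ) 1) (F : Finset (ℕ × ℕ))
    (G : ℕ × ℕ → ℕ → ℕ → ℝ) (T : ℕ × ℕ → ℝ) (hG : ∀ q ∈ F, biquadEval (G q) θ η ≤ T q)
    (hnum : 0 ≤ headQuadNumber ℓ a b F G) :
    0 ≤ ∑ q ∈ F, hrCoeff Δ ℓ q.1 q.2 * T q := by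
  refine sum_mul_nonneg_of_boxNumber hθ hη F G T (fun q => hrCoeff Δ ℓ q.1 q.2)
    (fun q => hrCoeff a ℓ q.1 q.2 * (pivotProd a ℓ q.1 / pivotProd b ℓ q.1))
    (fun q => hrCoeff b ℓ q.1 q.2 * (pivotProd b ℓ q.1 / pivotProd a ℓ q.1))
    (fun q _ => ⟨(hrCoeff_mem_Icc_cell ha hΔ.1 hΔ.2 q.1 q.2).1, (hrCoeff_mem_Icc_cell ha hΔ.1 hΔ.2 q.1 q.2).2⟩)
    (fun q _ => hrCoeff_nonneg_of_le (ha.trans hΔ.1) _ _) hG ?_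
  unfold headQuadNumber at hnum
  exact hnum

/-- **Quadratic head cell rule, regular points.** Nodes in the open square, `ℓ + 1 ≤ a`, fixed `s`;
for every `Δ ∈ [a, b]` some common box point `(θ, η)` at which every grid `G q` is below the head
term `Φ(Δ + n, j, s)`; `headQuadNumber ≥ 0`; tail terms non-negative on `[a + n, b + n]`. Then `φ` is
block-positive at every REGULAR `Δ ∈ [a, b]`. [cite: HogervorstRychkov2013, §3 eq. (3.9)] -/
theorem blockPositive_pointFunctional_of_headQuad {N : ℕ} (w z zb : Fin N → ℝ)
    (hz : ∀ k, z k ∈ Ioo (0 : ℝ) 1) (hzb : ∀ k, zb k ∈ Ioo (0 : ℝ) 1) {ℓ : ℕ} {a b s : ℝ}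
    (ha : (ℓ : ℝ) + 1 ≤ a) (F : Finset (ℕ × ℕ)) (G : ℕ × ℕ → ℕ → ℕ → ℝ)
    (hG : ∀ Δ ∈ Icc a b, ∃ θ ∈ Icc (0 : ℝ) 1, ∃ η ∈ Icc (0 : ℝ) 1, ∀ q ∈ F,
      biquadEval (G q) θ η ≤ pointFunctional w z zb (crossF s (-1) (zMono (Δ + (q.1 : ℝ)) q.2)))
    (hhead : 0 ≤ headQuadNumber ℓ a b F G)
    (htail : ∀ q : ℕ × ℕ, q ∉ F → InDescendantRange ℓ q.1 q.2 →
      ∀ E ∈ Icc (a + q.1) (b + q.1), 0 ≤ pointFunctional w z zb (crossF s (-1) (zMono E q.2))) :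
    ∀ Δ ∈ Icc a b, IsRegularPoint3D Δ ℓ → BlockPositive (pointFunctional w z zb) s Δ ℓ := by
  intro Δ hΔ hreg
  have hbd : unitarityBound3D ℓ ≤ Δ := ((unitarityBound3D_le_add_one ℓ).trans ha).trans hΔ.1
  have hlt : unitarityBound3D ℓ < Δ := lt_of_le_of_ne hbd (fun h => hreg.1 h.symm)
  refine blockPositive_pointFunctional_of_termwise w z zb hz hzb hlt hreg.2 F ?_ ?_
  · -- the head
    obtain ⟨θ, hθ, η, hη, hGq⟩ := hG Δ hΔ
    have hlam : 0 < legendreLam ℓ := legendreLam_pos ℓ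
    have hsum := headQuad_sum_nonneg ha hΔ hθ hη F G
      (fun q => pointFunctional w z zb (crossF s (-1) (zMono (Δ + (q.1 : ℝ)) q.2))) hGq hhead
    have hrw : ∑ q ∈ F, hrCoeff Δ ℓ q.1 q.2 / legendreLam ℓ *
        pointFunctional w z zb (crossF s (-1) (zMono (Δ + (q.1 : ℝ)) q.2)) =
        (1 / legendreLam ℓ) * ∑ q ∈ F, hrCoeff Δ ℓ q.1 q.2 *
          pointFunctional w z zb (crossF s (-1) (zMono (Δ + (q.1 : ℝ)) q.2)) := by
      rw [Finset.mul_sum]; exact Finset.sum_congr rfl (fun q _ => by ring)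
    rw [hrw]
    exact mul_nonneg (by positivity) hsum
  · -- the tail
    intro q hq hr
    exact htail q hq hr (Δ + (q.1 : ℝ)) ⟨by linarith [hΔ.1], by linarith [hΔ.2]⟩

/-- **Quadratic head cell rule, half-open cell**: every `Δ ∈ [a, b)`, the non-regular points by the
limit clause from the regular points to their right inside the cell.
[cite: HogervorstRychkov2013, §3 eq. (3.9)] -/
theorem blockPositive_pointFunctional_of_headQuad_Ico {N : ℕ} (w z zb : Fin N → ℝ)
    (hz : ∀ k, z k ∈ Ioo (0 : ℝ) 1) (hzb : ∀ k, zb k ∈ Ioo (0 : ℝ) 1) {ℓ : ℕ} {a b s : ℝ}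
    (ha : (ℓ : ℝ) + 1 ≤ a) (F : Finset (ℕ × ℕ)) (G : ℕ × ℕ → ℕ → ℕ → ℝ)
    (hG : ∀ Δ ∈ Icc a b, ∃ θ ∈ Icc (0 : ℝ) 1, ∃ η ∈ Icc (0 : ℝ) 1, ∀ q ∈ F,
      biquadEval (G q) θ η ≤ pointFunctional w z zb (crossF s (-1) (zMono (Δ + (q.1 : ℝ)) q.2)))
    (hhead : 0 ≤ headQuadNumber ℓ a b F G)
    (htail : ∀ q : ℕ × ℕ, q ∉ F → InDescendantRange ℓ q.1 q.2 →
      ∀ E ∈ Icc (a + q.1) (b + q.1), 0 ≤ pointFunctional w z zb (crossF s (-1) (zMono E q.2))) :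
    ∀ Δ ∈ Ico a b, BlockPositive (pointFunctional w z zb) s Δ ℓ := by
  intro Δ hΔ
  have hreg := blockPositive_pointFunctional_of_headQuad w z zb hz hzb ha F G hG hhead htail
  by_cases hr : IsRegularPoint3D Δ ℓ
  · exact hreg Δ ⟨hΔ.1, hΔ.2.le⟩ hr
  · have hbd : unitarityBound3D ℓ ≤ Δ := ((unitarityBound3D_le_add_one ℓ).trans ha).trans hΔ.1
    refine blockPositive_of_eventually_right w z zb hz hzb s Δ ℓ hr ?_
    filter_upwards [eventually_isRegularPoint3D_nhdsGT_of_bound_le hbd, Ioo_mem_nhdsGT hΔ.2]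
      with Δ' hΔ'reg hΔ'
    exact ⟨hΔ'reg, hreg Δ' ⟨hΔ.1.trans hΔ'.1.le, hΔ'.2.le⟩ hΔ'reg⟩

/-- The quadratic head-cell number with the TERM GRIDS of the head terms on
`[a + n, b + n] × [s_lo, s_hi]`: `headQuadNumber` with `G (n, j) = termQuadGrid w z z̄ j s_lo s_hi (a+n) (b+n)`.
[cite: HogervorstRychkov2013, §3 eq. (3.9)] -/
def headQuadBound {N : ℕ} (w z zb : Fin N → ℝ) (ℓ : ℕ) (a b slo shi : ℝ) (F : Finset (ℕ × ℕ)) : ℝ :=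
  headQuadNumber ℓ a b F (fun q => termQuadGrid w z zb q.2 slo shi (a + q.1) (b + q.1))

/-- **Quadratic head cell from the certificate's global data.** As
`headSum_pointFunctional_of_pointRules`: the external dimension runs over `Q` (`s = p.1 ∈ [s_lo, s_hi]`),
node ratios `≥ 1/2` for the `s`-width and the cell width, `a ≤ b`, `headQuadBound ≥ 0`; the tail terms
are discharged by the certificate's rules ((M) on `[E₀, E_T)`, (T) from `E_T` on). Then block
positivity on the half-open cell for every external dimension in the box.
[cite: HogervorstRychkov2013, §3 eq. (3.9)] -/
theorem headQuad_pointFunctional_of_pointRules {N : ℕ} (w z zb : Fin N → ℝ)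
    (hz : ∀ k, z k ∈ Ioo (0 : ℝ) 1) (hzb : ∀ k, zb k ∈ Ioo (0 : ℝ) 1) (hord : ∀ k, zb k ≤ z k)
    (apex : Fin N) (hapex : 0 ≤ w apex) (qd qr : Fin N → ℝ) (hqd : ∀ k, 0 < qd k ∧ qd k ≤ 1)
    (hqr : ∀ k, 0 < qr k ∧ qr k ≤ 1)
    (hdomd : ∀ k, z k * zb k ≤ qd k ^ 2 * (z apex * zb apex) ∧ z k ≤ qd k * z apex)
    (hdomr : ∀ k, (1 - z k) * (1 - zb k) ≤ qr k ^ 2 * (z apex * zb apex) ∧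
      1 - zb k ≤ qr k * z apex)
    {Q : Set (ℝ × ℝ)} {slo shi E₀ ET : ℝ} (hQ : ∀ p ∈ Q, slo ≤ p.1 ∧ p.1 ≤ shi)
    (hM : ∀ (j : ℕ) (E : ℝ), E₀ ≤ E → E < ET → (j : ℝ) + 1 / 2 ≤ E → ∀ p ∈ Q,
      0 ≤ pointFunctional w z zb (crossF p.1 (-1) (zMono E j)))
    (hB : ∑ k ∈ univ.erase apex, |w k| * ((1 - z k) * (1 - zb k)) ^ slo * qd k ^ ET
          + ∑ k, |w k| * (z k * zb k) ^ slo * qr k ^ ET ≤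
          w apex * ((1 - z apex) * (1 - zb apex)) ^ shi)
    {ℓ : ℕ} {a b : ℝ} (ha : (ℓ : ℝ) + 1 ≤ a) (hab : a ≤ b) (F : Finset (ℕ × ℕ))
    (hF : ∀ q : ℕ × ℕ, q ∉ F → InDescendantRange ℓ q.1 q.2 → E₀ ≤ a + q.1)
    (hr : ∀ k, 1 / 2 ≤ ((1 - z k) * (1 - zb k)) ^ (shi - slo) ∧ 1 / 2 ≤ (z k * zb k) ^ (shi - slo))
    (hρ : ∀ k, 1 / 2 ≤ (z k * zb k) ^ ((b - a) / 2) ∧ 1 / 2 ≤ ((1 - z k) * (1 - zb k)) ^ ((b - a) / 2))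
    (hhead : 0 ≤ headQuadBound w z zb ℓ a b slo shi F) :
    ∀ p ∈ Q, ∀ Δ ∈ Ico a b, BlockPositive (pointFunctional w z zb) p.1 Δ ℓ := by
  intro p hp
  have hs : p.1 ∈ Icc slo shi := ⟨(hQ p hp).1, (hQ p hp).2⟩
  refine blockPositive_pointFunctional_of_headQuad_Ico w z zb hz hzb ha F
    (fun q => termQuadGrid w z zb q.2 slo shi (a + q.1) (b + q.1)) ?_ hhead ?_
  · -- the grids at the common box point
    intro Δ hΔ
    obtain ⟨θ, hθ, hsθ⟩ := exists_boxCoord hs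
    obtain ⟨η, hη, hΔη⟩ := exists_boxCoord (slo := a) (shi := b) (s := Δ) hΔ
    refine ⟨θ, hθ, η, hη, fun q _ => ?_⟩
    show biquadEval (termQuadGrid w z zb q.2 slo shi (a + q.1) (b + q.1)) θ η ≤ _
    have hρ' : ∀ k, 1 / 2 ≤ (z k * zb k) ^ ((b + (q.1 : ℝ) - (a + q.1)) / 2) ∧
        1 / 2 ≤ ((1 - z k) * (1 - zb k)) ^ ((b + (q.1 : ℝ) - (a + q.1)) / 2) := by
      intro k; rw [show b + (q.1 : ℝ) - (a + q.1) = b - a by ring]; exact hρ k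
    have := termQuadGrid_le w z zb hz hzb q.2 (hs.1.trans hs.2) (by linarith : a + (q.1 : ℝ) ≤ b + q.1)
      hr hρ' hθ hη
    have hE : a + (q.1 : ℝ) + η * (b + q.1 - (a + q.1)) = Δ + q.1 := by rw [hΔη]; ring
    rwa [hE, ← hsθ] at this
  · -- the tail
    intro q hq hrq E hE
    have hjb : (q.2 : ℝ) + 1 / 2 ≤ E := by
      have h1 : q.2 ≤ ℓ + q.1 := hrq.2.1
      have h2 : (q.2 : ℝ) ≤ (ℓ : ℝ) + q.1 := by exact_mod_cast h1
      linarith [hE.1]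
    have hE0 : E₀ ≤ E := (hF q hq hrq).trans hE.1
    by_cases hET : E < ET
    · exact hM q.2 E hE0 hET hjb p hp
    · have hBs := apexIneq_of_box w z zb hz hzb apex hapex qd qr (fun k => (hqd k).1.le)
        (fun k => (hqr k).1.le) (hQ p hp) hB
      exact term_nonneg_of_apex w z zb hz hzb hord apex qd qr hqd hqr hdomd hdomr hBs
        (by linarith) (not_lt.1 hET)

/-! ### Coefficient sub-cells: re-parameterising the `η`-coordinate -/

/-- The grid of `(θ, η') ↦ P(θ, e₀ + c η')` for a grid `g` of `P`: the `η`-substitution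
`η = e₀ + c η'` (coefficient sub-cell `[a + e₀ (b - a), a + (e₀ + c)(b - a)]` of a cell `[a, b]`
whose node data are those of the whole cell). [folklore] -/
def gridSubst (g : ℕ → ℕ → ℝ) (e₀ c : ℝ) (i : ℕ) : ℕ → ℝ
  | 0 => g i 0 + g i 1 * e₀ + g i 2 * e₀ ^ 2
  | 1 => (g i 1 + 2 * g i 2 * e₀) * c
  | 2 => g i 2 * c ^ 2
  | _ => 0

/-- the substituted grid evaluates to the original at `η = e₀ + c η'`. [folklore] -/
theorem biquadEval_gridSubst (g : ℕ → ℕ → ℝ) (e₀ c θ η' : ℝ) :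
    biquadEval (gridSubst g e₀ c) θ η' = biquadEval g θ (e₀ + c * η') := by
  simp only [biquadEval, gridSubst, Finset.sum_range_succ, Finset.sum_range_zero]
  ring

/-- **Quadratic head sub-cell from the certificate's global data.** As
`headQuad_pointFunctional_of_pointRules`, for the coefficient sub-cell
`[a', b'] = [a + e₀ (b - a), a + (e₀ + c)(b - a)]` (`0 ≤ e₀`, `0 ≤ c`, `e₀ + c ≤ 1`) of the node
cell `[a, b]`: the number is `headQuadNumber ℓ a' b' F (gridSubst ∘ term grids of [a, b])`.
[cite: HogervorstRychkov2013, §3 eq. (3.9)] -/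
theorem headQuadSub_pointFunctional_of_pointRules {N : ℕ} (w z zb : Fin N → ℝ)
    (hz : ∀ k, z k ∈ Ioo (0 : ℝ) 1) (hzb : ∀ k, zb k ∈ Ioo (0 : ℝ) 1) (hord : ∀ k, zb k ≤ z k)
    (apex : Fin N) (hapex : 0 ≤ w apex) (qd qr : Fin N → ℝ) (hqd : ∀ k, 0 < qd k ∧ qd k ≤ 1)
    (hqr : ∀ k, 0 < qr k ∧ qr k ≤ 1)
    (hdomd : ∀ k, z k * zb k ≤ qd k ^ 2 * (z apex * zb apex) ∧ z k ≤ qd k * z apex)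
    (hdomr : ∀ k, (1 - z k) * (1 - zb k) ≤ qr k ^ 2 * (z apex * zb apex) ∧
      1 - zb k ≤ qr k * z apex)
    {Q : Set (ℝ × ℝ)} {slo shi E₀ ET : ℝ} (hQ : ∀ p ∈ Q, slo ≤ p.1 ∧ p.1 ≤ shi)
    (hM : ∀ (j : ℕ) (E : ℝ), E₀ ≤ E → E < ET → (j : ℝ) + 1 / 2 ≤ E → ∀ p ∈ Q,
      0 ≤ pointFunctional w z zb (crossF p.1 (-1) (zMono E j)))
    (hB : ∑ k ∈ univ.erase apex, |w k| * ((1 - z k) * (1 - zb k)) ^ slo * qd k ^ ET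
          + ∑ k, |w k| * (z k * zb k) ^ slo * qr k ^ ET ≤
          w apex * ((1 - z apex) * (1 - zb apex)) ^ shi)
    {ℓ : ℕ} {a b e₀ c : ℝ} (ha : (ℓ : ℝ) + 1 ≤ a) (hab : a ≤ b) (he₀ : 0 ≤ e₀) (hc : 0 ≤ c)
    (hec : e₀ + c ≤ 1) (F : Finset (ℕ × ℕ))
    (hF : ∀ q : ℕ × ℕ, q ∉ F → InDescendantRange ℓ q.1 q.2 → E₀ ≤ a + q.1)
    (hr : ∀ k, 1 / 2 ≤ ((1 - z k) * (1 - zb k)) ^ (shi - slo) ∧ 1 / 2 ≤ (z k * zb k) ^ (shi - slo))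
    (hρ : ∀ k, 1 / 2 ≤ (z k * zb k) ^ ((b - a) / 2) ∧ 1 / 2 ≤ ((1 - z k) * (1 - zb k)) ^ ((b - a) / 2))
    (hhead : 0 ≤ headQuadNumber ℓ (a + e₀ * (b - a)) (a + (e₀ + c) * (b - a)) F
      (fun q => gridSubst (termQuadGrid w z zb q.2 slo shi (a + q.1) (b + q.1)) e₀ c)) :
    ∀ p ∈ Q, ∀ Δ ∈ Ico (a + e₀ * (b - a)) (a + (e₀ + c) * (b - a)),
      BlockPositive (pointFunctional w z zb) p.1 Δ ℓ := by
  intro p hp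
  have hs : p.1 ∈ Icc slo shi := ⟨(hQ p hp).1, (hQ p hp).2⟩
  have hba : 0 ≤ b - a := sub_nonneg.2 hab
  have ha' : (ℓ : ℝ) + 1 ≤ a + e₀ * (b - a) := ha.trans (le_add_of_nonneg_right (mul_nonneg he₀ hba))
  refine blockPositive_pointFunctional_of_headQuad_Ico w z zb hz hzb ha' F
    (fun q => gridSubst (termQuadGrid w z zb q.2 slo shi (a + q.1) (b + q.1)) e₀ c) ?_ hhead ?_
  · -- the grids at the common box point
    intro Δ hΔ
    obtain ⟨θ, hθ, hsθ⟩ := exists_boxCoord hs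
    obtain ⟨η', hη', hΔη⟩ := exists_boxCoord (slo := a + e₀ * (b - a))
      (shi := a + (e₀ + c) * (b - a)) (s := Δ) hΔ
    refine ⟨θ, hθ, η', hη', fun q _ => ?_⟩
    show biquadEval (gridSubst (termQuadGrid w z zb q.2 slo shi (a + q.1) (b + q.1)) e₀ c) θ η' ≤ _
    rw [biquadEval_gridSubst]
    have hη : e₀ + c * η' ∈ Icc (0 : ℝ) 1 :=
      ⟨add_nonneg he₀ (mul_nonneg hc hη'.1), by nlinarith [hη'.2, hc]⟩
    have hρ' : ∀ k, 1 / 2 ≤ (z k * zb k) ^ ((b + (q.1 : ℝ) - (a + q.1)) / 2) ∧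
        1 / 2 ≤ ((1 - z k) * (1 - zb k)) ^ ((b + (q.1 : ℝ) - (a + q.1)) / 2) := by
      intro k; rw [show b + (q.1 : ℝ) - (a + q.1) = b - a by ring]; exact hρ k
    have := termQuadGrid_le w z zb hz hzb q.2 (hs.1.trans hs.2) (by linarith : a + (q.1 : ℝ) ≤ b + q.1)
      hr hρ' hθ hη
    have hE : a + (q.1 : ℝ) + (e₀ + c * η') * (b + q.1 - (a + q.1)) = Δ + q.1 := by rw [hΔη]; ring
    rwa [hE, ← hsθ] at this
  · -- the tail (on the sub-cell, inside the cell)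
    intro q hq hrq E hE
    have hjb : (q.2 : ℝ) + 1 / 2 ≤ E := by
      have h1 : q.2 ≤ ℓ + q.1 := hrq.2.1
      have h2 : (q.2 : ℝ) ≤ (ℓ : ℝ) + q.1 := by exact_mod_cast h1
      have h3 : a ≤ a + e₀ * (b - a) := le_add_of_nonneg_right (mul_nonneg he₀ hba)
      linarith [hE.1]
    have hE0 : E₀ ≤ E := by
      have h3 : (0 : ℝ) ≤ e₀ * (b - a) := mul_nonneg he₀ hba
      linarith [hF q hq hrq, hE.1]
    by_cases hET : E < ET
    · exact hM q.2 E hE0 hET hjb p hp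
    · have hBs := apexIneq_of_box w z zb hz hzb apex hapex qd qr (fun k => (hqd k).1.le)
        (fun k => (hqr k).1.le) (hQ p hp) hB
      exact term_nonneg_of_apex w z zb hz hzb hord apex qd qr hqd hqr hdomd hdomr hBs
        (by linarith) (not_lt.1 hET)

/-- **Uniform coefficient sub-cells.** The cell `[a, b]` cut into `m ≥ 1` equal coefficient
sub-cells `[a + (i/m)(b-a), a + ((i+1)/m)(b-a)]`, each with its own non-negative number; then block
positivity on the whole half-open cell. [cite: HogervorstRychkov2013, §3 eq. (3.9)] -/
theorem headQuadSubcells_pointFunctional_of_pointRules {N : ℕ} (w z zb : Fin N → ℝ)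
    (hz : ∀ k, z k ∈ Ioo (0 : ℝ) 1) (hzb : ∀ k, zb k ∈ Ioo (0 : ℝ) 1) (hord : ∀ k, zb k ≤ z k)
    (apex : Fin N) (hapex : 0 ≤ w apex) (qd qr : Fin N → ℝ) (hqd : ∀ k, 0 < qd k ∧ qd k ≤ 1)
    (hqr : ∀ k, 0 < qr k ∧ qr k ≤ 1)
    (hdomd : ∀ k, z k * zb k ≤ qd k ^ 2 * (z apex * zb apex) ∧ z k ≤ qd k * z apex)
    (hdomr : ∀ k, (1 - z k) * (1 - zb k) ≤ qr k ^ 2 * (z apex * zb apex) ∧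
      1 - zb k ≤ qr k * z apex)
    {Q : Set (ℝ × ℝ)} {slo shi E₀ ET : ℝ} (hQ : ∀ p ∈ Q, slo ≤ p.1 ∧ p.1 ≤ shi)
    (hM : ∀ (j : ℕ) (E : ℝ), E₀ ≤ E → E < ET → (j : ℝ) + 1 / 2 ≤ E → ∀ p ∈ Q,
      0 ≤ pointFunctional w z zb (crossF p.1 (-1) (zMono E j)))
    (hB : ∑ k ∈ univ.erase apex, |w k| * ((1 - z k) * (1 - zb k)) ^ slo * qd k ^ ET
          + ∑ k, |w k| * (z k * zb k) ^ slo * qr k ^ ET ≤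
          w apex * ((1 - z apex) * (1 - zb apex)) ^ shi)
    {ℓ : ℕ} {a b : ℝ} (ha : (ℓ : ℝ) + 1 ≤ a) (hab : a ≤ b) (F : Finset (ℕ × ℕ))
    (hF : ∀ q : ℕ × ℕ, q ∉ F → InDescendantRange ℓ q.1 q.2 → E₀ ≤ a + q.1)
    (hr : ∀ k, 1 / 2 ≤ ((1 - z k) * (1 - zb k)) ^ (shi - slo) ∧ 1 / 2 ≤ (z k * zb k) ^ (shi - slo))
    (hρ : ∀ k, 1 / 2 ≤ (z k * zb k) ^ ((b - a) / 2) ∧ 1 / 2 ≤ ((1 - z k) * (1 - zb k)) ^ ((b - a) / 2))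
    {m : ℕ} (hm : 0 < m)
    (hhead : ∀ i < m, 0 ≤ headQuadNumber ℓ (a + (i : ℝ) / m * (b - a)) (a + ((i : ℝ) / m + 1 / m) * (b - a)) F
      (fun q => gridSubst (termQuadGrid w z zb q.2 slo shi (a + q.1) (b + q.1)) ((i : ℝ) / m) (1 / m))) :
    ∀ p ∈ Q, ∀ Δ ∈ Ico a b, BlockPositive (pointFunctional w z zb) p.1 Δ ℓ := by
  intro p hp Δ hΔ
  have hmR : (0 : ℝ) < m := by exact_mod_cast hm
  -- locate the sub-cell
  set t : ℕ → ℝ := fun i => a + (i : ℝ) / m * (b - a) with ht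
  have ht0 : t 0 = a := by simp [ht]
  have htm : t m = b := by
    simp only [ht]
    rw [div_self (ne_of_gt hmR)]; ring
  obtain ⟨i, hi, hΔi⟩ := exists_cell_Ico t m Δ (by rw [ht0, htm]; exact hΔ)
  have hi1 : t (i + 1) = a + ((i : ℝ) / m + 1 / m) * (b - a) := by
    simp only [ht, Nat.cast_add, Nat.cast_one]; ring
  rw [hi1] at hΔi
  have he₀ : (0 : ℝ) ≤ (i : ℝ) / m := by positivity
  have hc : (0 : ℝ) ≤ 1 / m := by positivity
  have hec : (i : ℝ) / m + 1 / m ≤ 1 := by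
    rw [← add_div, div_le_one hmR]; exact_mod_cast hi
  exact headQuadSub_pointFunctional_of_pointRules w z zb hz hzb hord apex hapex qd qr hqd hqr hdomd hdomr
    hQ hM hB ha hab he₀ hc hec F hF hr hρ (hhead i hi) p hp Δ hΔi

end Literature.MathematicalPhysics.QuantumFieldTheory.ConformalBootstrap3D
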